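/-
Copyright: the b2b-balaban T⁴-continuum CRUX team, row NE7b OWNER lineage `t4-ne7b-p1` (gen 123). Project licence.
-/
import Summits.QuantumFields.BalabanUV.T4Continuum.Spine.NE7b.SupZdCoarseForm

/-!
# THE INFINITE-VOLUME COARSE OPERATOR IS LIPSCHITZ IN THE BACKGROUND POTENTIAL, WITH DECAY: for `V₁, V₂ : ℤ^d → [−λ, Λ]` with
# `|V₁ − V₂| ≤ D` and ANY bounded block columns `Ψ¹, Ψ²` of `H_{V₁}, H_{V₂}` on `ℤ^d`, the Schur-complement entries satisfy
# `|T¹_∞(b,b′) − T²_∞(b,b′)| ≤ C·D·e^{−δ|b − b′|₁}` ((182)'s decay-currency Lipschitz letter, block-averaged), hence the difference of the quadratic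
# forms is `ℓ²`-bounded by `C·K_δ·D` on finitely supported functions ((191)'s Schur test) — the next-scale operator of the road depends
# Lipschitz-continuously on the background, in infinite volume, every mesh, `d ≥ 3` (row NE7b, node U5c; (182)∕(186)∕(191) BY NAME; [folklore])

Cell `pub-balaban`, sub-cell `t4`, spine estimate NE7b (`T4WeightBudget.RelWeightBound`; the cell's OWN estimate — NOT PRINTED in
[Bałaban 1983–89], NOT PROVED).  Crux-route work under `Spine/NE7b/` by the row OWNER (`t4-ne7b-p1` gen 123, file (192)) under FREEZE
(0)'s crux-prover clause; NOTHING of Bałaban's is named as a Lean object, valued or asserted; no `T4Continuum/Support` leaf typed; no `def`,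
no notation (the `ℤ^d` operator and every entry DISPLAYED); zero `sorry`.  Imports (BY NAME): the OWNER's (191) `…SupZdCoarseForm`
(`kernel_l2_bound`, `kernel_form_sq_le`; through it (182) `zd_propagator_lipschitz_potential`, [B6] `mem_B`, `sum_B_const`).

WHY (located).  The road's step must be smooth in the background field; on the torus the column's Lipschitz letters are (141)∕(143)∕(157)∕
(177), on `ℤ^d` (182)∕(184)∕(188).  The coarse operator inherits them entrywise: `T¹_∞(b,b′) − T²_∞(b,b′)` is the block mean over `B n b` of
`Ψ¹_{b′} − Ψ²_{b′}`, two bounded solutions of `H_{V₁}u = 𝟙_{B n b′}`, `H_{V₂}u = 𝟙_{B n b′}`, for which (182) gives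
`e^{δ|blk n p − b′|₁}|Ψ¹_{b′} p − Ψ²_{b′} p| ≤ C·D`; the block mean keeps the factor `e^{−δ|b − b′|₁}` (every `p ∈ B n b` has `blk n p = b`), and
(191)'s Schur test turns the entrywise letter into the `ℓ²` letter for the forms.

WHAT IS PROVED ([folklore]; `X d = ℤ^d`; the `ℤ^d` operator DISPLAYED; `T^i_∞(b,b′) = (n+1)^{−d}Σ_{q ∈ B n b}Ψ^i_{b′} q`; `K_δ = (2∕(1 − e^{−δ}))^d`):
* §1 **`zd_coarse_entry_lipschitz`**: `d ≥ 3`, `a > 0`, `λ < min(2,a)`, `Λ ≥ 0` ⟹ `∃ C δ > 0` (from `(d, a, λ, Λ)` only): for ALL `n`, `V₁, V₂ : ℤ^d →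
  [−λ, Λ]` with `|V₁ − V₂| ≤ D`, ANY bounded block columns `Ψ¹` of `H_{V₁}` and `Ψ²` of `H_{V₂}`, all `b, b′`:
  `|T¹_∞(b,b′) − T²_∞(b,b′)| ≤ C·D·e^{−δ|b − b′|₁}`.
* §2 **`zd_coarse_form_lipschitz`**: `∃ C > 0`: … for every finite `S` and all `g, h`:
  `(Σ_{b ∈ S}h b·Σ_{b′ ∈ S}(T¹_∞ − T²_∞)(b,b′)·g b′)² ≤ (C·D)²·(Σ_S h²)(Σ_S g²)` and `Σ_{b ∈ S}(Σ_{b′ ∈ S}(T¹_∞ − T²_∞)(b,b′)g b′)² ≤ (C·D)²Σ_S g²`.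
* §3 toy (`d = 3`).

HONEST (what this is NOT).  Entrywise and `ℓ²`-form Lipschitz letters only (the inverse `T_∞⁻¹` and its Lipschitz dependence are the sequel);
`d ≥ 3` only; the LINEAR column only; scalar skeleton ((A3), NC-NE7b-α UNRULED); nothing of the covariant propagators of [B4]–[B6]; nothing
of Bałaban's.  BY-NAME EFFECT ON THE WALL: NONE.  NE7b NOT PRINTED ∕ NOT PROVED; spine PROVED 0∕9; rung (B)+1 — the programme's measures
remain FINITE-torus statements; NOT the mass gap, NOT Clay.  HONEST DEPENDENCY: continuum YM on T⁴ ⇐ BetaPertH ∧ nine spine estimates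
(0∕9 proved); BetaPertH ⇐ (D1) ∧ (D4) ∧ CAP+tail; G-an2-4 gates asym, D1 and NE2∕3∕4.
-/

set_option autoImplicit false

noncomputable section

namespace Summit.QuantumFields.BalabanUV.T4Continuum.NE7b.SupZdCoarseLipschitz

open Real
open Literature.MathematicalPhysics.QuantumFieldTheory.Balaban1983to89
open B6QGQLower276 (X e blk B side chart mem_B sum_B sum_B_const card_cube blk_chart)
open SupZdPropagatorProfile (zd_propagator_lipschitz_potential)
open SupZdCoarseForm (kernel_l2_bound kernel_form_sq_le)

variable {d : ℕ}

/-! ## §1. The entries of `T_∞` are Lipschitz in the potential, with decay -/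

/-- **`|T¹_∞(b,b′) − T²_∞(b,b′)| ≤ C·‖V₁ − V₂‖_∞·e^{−δ|b − b′|₁}`** for ANY bounded block columns of `H_{V₁}`, `H_{V₂}` on `ℤ^d`, `V_i : ℤ^d → [−λ, Λ]`,
`d ≥ 3`, every mesh — (182) `zd_propagator_lipschitz_potential` on the block source `𝟙_{B n b′}` (`M = 1`), averaged over `B n b`. [folklore] -/
theorem zd_coarse_entry_lipschitz (hd : 3 ≤ d) (a : ℝ) (ha : 0 < a) {lam Lam : ℝ} (hlam : lam < min 2 a) (hLam : 0 ≤ Lam) :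
    ∃ C δ : ℝ, 0 < C ∧ 0 < δ ∧ ∀ (n : ℕ) (V₁ V₂ : X d → ℝ), (∀ p, -lam ≤ V₁ p) → (∀ p, V₁ p ≤ Lam) →
      (∀ p, -lam ≤ V₂ p) → (∀ p, V₂ p ≤ Lam) → ∀ D : ℝ, (∀ p, |V₁ p - V₂ p| ≤ D) →
      ∀ (Ψ₁ Ψ₂ : X d → X d → ℝ) (B₁ B₂ : X d → ℝ), (∀ b' p, |Ψ₁ b' p| ≤ B₁ b') → (∀ b' p, |Ψ₂ b' p| ≤ B₂ b') →
      (∀ b' p, ((n : ℝ) + 1) ^ 2 * ∑ μ, (2 * Ψ₁ b' p - Ψ₁ b' (p + e μ) - Ψ₁ b' (p - e μ))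
        + a / ((n : ℝ) + 1) ^ d * ∑ q ∈ B n (blk n p), Ψ₁ b' q + V₁ p * Ψ₁ b' p = if blk n p = b' then 1 else 0) →
      (∀ b' p, ((n : ℝ) + 1) ^ 2 * ∑ μ, (2 * Ψ₂ b' p - Ψ₂ b' (p + e μ) - Ψ₂ b' (p - e μ))
        + a / ((n : ℝ) + 1) ^ d * ∑ q ∈ B n (blk n p), Ψ₂ b' q + V₂ p * Ψ₂ b' p = if blk n p = b' then 1 else 0) →
      ∀ b b' : X d,
        |(((n : ℝ) + 1) ^ d)⁻¹ * ∑ q ∈ B n b, Ψ₁ b' q - (((n : ℝ) + 1) ^ d)⁻¹ * ∑ q ∈ B n b, Ψ₂ b' q|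
          ≤ C * D * exp (-(δ * ∑ i, (((b i - b' i).natAbs : ℕ) : ℝ))) := by
  classical
  obtain ⟨C, δ, hC, hδ, H182⟩ := zd_propagator_lipschitz_potential (d := d) hd a ha hlam hLam
  refine ⟨C, δ, hC, hδ, ?_⟩
  intro n V₁ V₂ hV₁ hV₁' hV₂ hV₂' D hD Ψ₁ Ψ₂ B₁ B₂ hΨ₁B hΨ₂B hΨ₁ hΨ₂ b b'
  have hvol : (0 : ℝ) < ((n : ℝ) + 1) ^ d := by positivity
  -- (182) on the block source `𝟙_{B n b′}` with `M = 1`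
  have hlip : ∀ p : X d, exp (δ * ∑ i, (((blk n p i - b' i).natAbs : ℕ) : ℝ)) * |Ψ₁ b' p - Ψ₂ b' p| ≤ C * D * 1 := fun p =>
    H182 n V₁ V₂ hV₁ hV₁' hV₂ hV₂' D hD b' 1 (fun p' => if blk n p' = b' then (1 : ℝ) else 0) (fun p' hp' => by rw [if_neg hp'])
      (fun p' => by split_ifs <;> simp) (Ψ₁ b') (Ψ₂ b') (B₁ b') (B₂ b') (hΨ₁B b') (hΨ₂B b') (hΨ₁ b') (hΨ₂ b') p
  -- every `q ∈ B n b` carries `e^{−δ|b − b′|₁}`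
  have hq : ∀ q ∈ B n b, |Ψ₁ b' q - Ψ₂ b' q| ≤ C * D * exp (-(δ * ∑ i, (((b i - b' i).natAbs : ℕ) : ℝ))) := fun q hqB => by
    have h := hlip q
    rw [mem_B.1 hqB, mul_one] at h
    have hE := exp_pos (δ * ∑ i, (((b i - b' i).natAbs : ℕ) : ℝ))
    rw [exp_neg, ← div_eq_mul_inv, le_div_iff₀ hE, mul_comm]; exact h
  rw [← mul_sub, ← Finset.sum_sub_distrib, abs_mul, abs_inv, abs_of_pos hvol, inv_mul_le_iff₀ hvol]
  calc |∑ q ∈ B n b, (Ψ₁ b' q - Ψ₂ b' q)| ≤ ∑ q ∈ B n b, |Ψ₁ b' q - Ψ₂ b' q| := Finset.abs_sum_le_sum_abs _ _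
    _ ≤ ∑ _q ∈ B n b, C * D * exp (-(δ * ∑ i, (((b i - b' i).natAbs : ℕ) : ℝ))) := Finset.sum_le_sum hq
    _ = ((n : ℝ) + 1) ^ d * (C * D * exp (-(δ * ∑ i, (((b i - b' i).natAbs : ℕ) : ℝ)))) := sum_B_const _ _

/-! ## §2. THE END: the quadratic forms of `T_∞` are Lipschitz in the potential, in `ℓ²` -/

/-- **HEADLINE — THE FORM OF `T_∞` IS `ℓ²`-LIPSCHITZ IN THE POTENTIAL**: `∃ C > 0` (from `(d, a, λ, Λ)` only): for ALL `n`, `V₁, V₂ : ℤ^d →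
[−λ, Λ]` with `|V₁ − V₂| ≤ D`, ANY bounded block columns `Ψ¹, Ψ²`, every finite `S` and all coarse `g, h`:
`(Σ_{b ∈ S}h b·Σ_{b′ ∈ S}(T¹_∞ − T²_∞)(b,b′)·g b′)² ≤ (C·D)²(Σ_S h²)(Σ_S g²)` and `Σ_{b ∈ S}(Σ_{b′ ∈ S}(T¹_∞ − T²_∞)(b,b′)g b′)² ≤ (C·D)²Σ_S g²` —
§1 and (191)'s Schur test applied to the kernel `T¹_∞ − T²_∞`. [folklore] -/
theorem zd_coarse_form_lipschitz (hd : 3 ≤ d) (a : ℝ) (ha : 0 < a) {lam Lam : ℝ} (hlam : lam < min 2 a) (hLam : 0 ≤ Lam) :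
    ∃ C : ℝ, 0 < C ∧ ∀ (n : ℕ) (V₁ V₂ : X d → ℝ), (∀ p, -lam ≤ V₁ p) → (∀ p, V₁ p ≤ Lam) →
      (∀ p, -lam ≤ V₂ p) → (∀ p, V₂ p ≤ Lam) → ∀ D : ℝ, (∀ p, |V₁ p - V₂ p| ≤ D) →
      ∀ (Ψ₁ Ψ₂ : X d → X d → ℝ) (B₁ B₂ : X d → ℝ), (∀ b' p, |Ψ₁ b' p| ≤ B₁ b') → (∀ b' p, |Ψ₂ b' p| ≤ B₂ b') →
      (∀ b' p, ((n : ℝ) + 1) ^ 2 * ∑ μ, (2 * Ψ₁ b' p - Ψ₁ b' (p + e μ) - Ψ₁ b' (p - e μ))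
        + a / ((n : ℝ) + 1) ^ d * ∑ q ∈ B n (blk n p), Ψ₁ b' q + V₁ p * Ψ₁ b' p = if blk n p = b' then 1 else 0) →
      (∀ b' p, ((n : ℝ) + 1) ^ 2 * ∑ μ, (2 * Ψ₂ b' p - Ψ₂ b' (p + e μ) - Ψ₂ b' (p - e μ))
        + a / ((n : ℝ) + 1) ^ d * ∑ q ∈ B n (blk n p), Ψ₂ b' q + V₂ p * Ψ₂ b' p = if blk n p = b' then 1 else 0) →
      ∀ (S : Finset (X d)) (g h : X d → ℝ),
        (∑ b ∈ S, h b * ∑ b' ∈ S, ((((n : ℝ) + 1) ^ d)⁻¹ * ∑ q ∈ B n b, Ψ₁ b' q - (((n : ℝ) + 1) ^ d)⁻¹ * ∑ q ∈ B n b, Ψ₂ b' q) * g b') ^ 2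
            ≤ (C * D) ^ 2 * (∑ b ∈ S, h b ^ 2) * ∑ b' ∈ S, g b' ^ 2 ∧
        ∑ b ∈ S, (∑ b' ∈ S, ((((n : ℝ) + 1) ^ d)⁻¹ * ∑ q ∈ B n b, Ψ₁ b' q - (((n : ℝ) + 1) ^ d)⁻¹ * ∑ q ∈ B n b, Ψ₂ b' q) * g b') ^ 2
            ≤ (C * D) ^ 2 * ∑ b' ∈ S, g b' ^ 2 := by
  obtain ⟨C, δ, hC, hδ, H1⟩ := zd_coarse_entry_lipschitz (d := d) hd a ha hlam hLam
  have hK : 0 < (2 * (1 - exp (-δ))⁻¹) ^ d := pow_pos (mul_pos two_pos (inv_pos.2 (sub_pos.2 (exp_lt_one_iff.2 (by linarith))))) d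
  refine ⟨C * (2 * (1 - exp (-δ))⁻¹) ^ d, by positivity, ?_⟩
  intro n V₁ V₂ hV₁ hV₁' hV₂ hV₂' D hD Ψ₁ Ψ₂ B₁ B₂ hΨ₁B hΨ₂B hΨ₁ hΨ₂ S g h
  have hT : ∀ b b' : X d, |(((n : ℝ) + 1) ^ d)⁻¹ * ∑ q ∈ B n b, Ψ₁ b' q - (((n : ℝ) + 1) ^ d)⁻¹ * ∑ q ∈ B n b, Ψ₂ b' q|
      ≤ C * D * exp (-(δ * ∑ i, (((b i - b' i).natAbs : ℕ) : ℝ))) :=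
    fun b b' => H1 n V₁ V₂ hV₁ hV₁' hV₂ hV₂' D hD Ψ₁ Ψ₂ B₁ B₂ hΨ₁B hΨ₂B hΨ₁ hΨ₂ b b'
  have h1 := kernel_form_sq_le hδ (fun b b' => (((n : ℝ) + 1) ^ d)⁻¹ * ∑ q ∈ B n b, Ψ₁ b' q - (((n : ℝ) + 1) ^ d)⁻¹ * ∑ q ∈ B n b, Ψ₂ b' q)
    hT S g h
  have h2 := kernel_l2_bound hδ (fun b b' => (((n : ℝ) + 1) ^ d)⁻¹ * ∑ q ∈ B n b, Ψ₁ b' q - (((n : ℝ) + 1) ^ d)⁻¹ * ∑ q ∈ B n b, Ψ₂ b' q)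
    hT S g
  have e : (C * D * (2 * (1 - exp (-δ))⁻¹) ^ d) ^ 2 = (C * (2 * (1 - exp (-δ))⁻¹) ^ d * D) ^ 2 := by ring
  rw [e] at h1 h2
  exact ⟨h1, h2⟩

/-! ## §3. Toy -/

/-- Toy (`d = 3`, `a = 1`, `λ = 0`, `Λ = 1`): the Lipschitz constants exist. -/
example : ∃ C δ : ℝ, 0 < C ∧ 0 < δ :=
  let ⟨C, δ, hC, hδ, _⟩ := zd_coarse_entry_lipschitz (d := 3) le_rfl 1 one_pos (lam := 0) (Lam := 1)
    (by rw [min_eq_right (by norm_num : (1 : ℝ) ≤ 2)]; norm_num) zero_le_one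
  ⟨C, δ, hC, hδ⟩

end Summit.QuantumFields.BalabanUV.T4Continuum.NE7b.SupZdCoarseLipschitz
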